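import Literature.MathematicalPhysics.StatisticalMechanics.Yuhjtman2015
import Literature.MathematicalPhysics.StatisticalMechanics.Yuhjtman2015Radial
import Literature.MathematicalPhysics.StatisticalMechanics.Yuhjtman2015Theta
import HarnessLib

/-!
# Proof of Yuhjtman's bound `d_min > 0.684` for optimal Lennard-Jones clusters (discharge)

DISCHARGE of the named fact `Yuhjtman2015_minDistance` (`Yuhjtman2015.lean`):
`theorem Yuhjtman2015_minDistance_holds`, following S. A. Yuhjtman, *A sensible estimate for the
stability constant of the Lennard-Jones potential*, J. Stat. Phys. 160 (2015) =
arXiv:1501.05248, §3 (Prop. 4, Prop. 5, Cor. 7), with the one-variable facts of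
`Yuhjtman2015Theta.lean` and the shell formula of `Yuhjtman2015Radial.lean`. All results are
proved; nothing is defined and no named fact is introduced.

## Part 1: the three numerical inequalities (exact rational arithmetic)

`w₀ = (11/5)^{1/6}` enters only through `w₀⁶ = 11/5` and the bracket `1.14043 < w₀ < 1.14044`;
thresholds are written as fractions (`0.64 = 16/25`, `1.14 = 57/50`, `0.89 = 89/100`,
`0.684 = 171/250`, `0.342 = 171/500`).

* `integral_sq_mul_θ_le` — `J(R) = ∫_{0.64}^{R} v² θ(v) dv ≤ 1.002` for every `R ≥ w₀`
  (printed, Prop. 5 II: `(24/a³) ∫_{0.64}^∞ θ(w) w² dw < 24.05/a³`, i.e. `J < 1.00208`; in fact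
  `J(∞) = 1.00192…`);
* `clubsuit` — the inequality (♣) of the proof of Prop. 5 II in the form
  `(4/3) c³ r ≤ ∫_{0.64}^{1.14} (A - B v)(c² - (v - r)²) dv` for `c ∈ [1/4, 0.342]`,
  `r ∈ [0.89, 0.64 + c]` (printed for `c ∈ [0.3, 0.35]` with upper limit `1.19`; the wider range of
  `c`, with the upper limit `1.14 ≤ r + c`, lets Prop. 5 II cover every `a = 2c ≤ 0.684`).
  Proof: replace `A` by the rational lower bound `Alo`, evaluate the integral
  (`Gpoly + (4/3)c³r`), and check `Gpoly ≥ 0` on the box: `Gpoly` is concave in `r`, and on the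
  two edges `r = 0.89`, `r = 0.64 + c` it is a polynomial in `c` with positive Bernstein
  coefficients on `[1/4, 0.342]`;
* `final_ineq` — `2 a⁶ + 24 · 1.002 · a⁹ < 1` for `0 ≤ a ≤ 0.684` (printed, Cor. 7:
  "`24.05 a⁹ + 2a⁶ ≥ 1` … does not hold for `a ≤ 0.684`").

## Part 2: the argument in `ℝ³`

The printed argument and its transcription:

1. (Cor. 7) Let `a` be the minimal distance of a ground state, attained at `x₀, y₀`. By the
   removal inequality (`siteEnergy_nonpos_of_isGroundState` of `LennardJonesClusters.lean`) the
   minus-energy of `x₀` is `≥ 0`: `0 ≤ h(a) + Σ_{z ≠ x₀, y₀} h(‖z - x₀‖)`, and the points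
   `z - x₀` are `a`-separated.
2. (Prop. 5, `sum_hLJ_norm_le`) For an `a`-separated finite family, `a = 2c ≤ 0.684`:
   `Σ h(‖z‖) ≤ (3/c³) J`, `J = ∫_{0.64}^{R} v² θ ≤ 1.002` (`integral_sq_mul_θ_le`). Indeed points
   with `‖z‖ ≤ 0.89` have `h ≤ 0`; for the others (`ball_integral_ge`)
   `(4π/3) c³ h(‖z‖) ≤ ∫_{B(z,c)} θ^{0.64}(‖y‖) dy` — by the **ball mean-value inequality** for
   the radial majorant `θ ≥ h` when `B(z,c)` avoids `B(0, 0.64)` (Prop. 4; here from the shell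
   formula `setIntegral_ball_fun_norm` and the midpoint inequality `two_mul_gθ_le`, i.e. the
   convexity of `v θ(v)`, instead of the Laplacian), and by the explicit computation (♣)
   (`clubsuit`) when `0.89 ≤ ‖z‖ < 0.64 + c` — and the balls `B(z, c)` are disjoint, so the
   integrals add up to at most `∫_{0.64 ≤ ‖y‖ ≤ R} θ(‖y‖) dy = 4π J`
   (`integral_closedBall_θcut`, Mathlib's polar coordinates `integral_fun_norm_addHaar`).
3. Hence `0 ≤ h(a) + 24 J/a³`, i.e. `1 ≤ 2a⁶ + 24 J a⁹`, impossible for `a ≤ 0.684`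
   (`final_ineq`).

Deviation from the printed proof: Prop. 5 I (threshold `0.54`, constant `26.95`) is not needed,
because (♣) is verified for all `c ∈ [1/4, 0.342]` (`Yuhjtman2015.clubsuit`), which
makes the bound `μ(a) ≤ 24 J/a³` of Prop. 5 II valid for every `0 < a ≤ 0.684`.
-/

noncomputable section

open Set Metric Module Filter
open _root_.MeasureTheory _root_.MeasureTheory.Measure intervalIntegral
open scoped ENNReal NNReal Topology BigOperators

namespace Literature.MathematicalPhysics.StatisticalMechanics

namespace Yuhjtman2015

/-! ### `J = ∫_{0.64}^{R} v² θ ≤ 1.002` -/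

/-- `θ(w₀) = h(w₀)`: the two branches of `θ` agree at `w₀`. [cite: Yuhjtman2015, Prop. 3 (a)] -/
theorem hLJ_w₀ : hLJ w₀ = A / w₀ - B := by
  have h := gLJ_w₀
  rw [← mul_hLJ w₀_pos.ne'] at h
  have h0 := w₀_pos.ne'
  field_simp
  linarith

/-- `0.64 ≤ w₀`. [cite: Yuhjtman2015, §2] -/
theorem m_le_w₀ : (16 / 25 : ℝ) ≤ w₀ := by have := w₀_bounds.1; linarith

/-- `v² θ(v)` is interval integrable on `[a, b] ⊆ [0.64, ∞)` (bounded and measurable).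
[folklore] -/
theorem intervalIntegrable_sq_mul_θ {a b : ℝ} (ha : 16 / 25 ≤ a) (hab : a ≤ b) :
    IntervalIntegrable (fun v ↦ v ^ 2 * θ v) volume a b := by
  have hm : (0 : ℝ) < 16 / 25 := by norm_num
  refine (intervalIntegrable_const (c := b ^ 2 * (A / (16 / 25)))).mono_fun
    ((measurable_id.pow_const 2).mul measurable_θ).aestronglyMeasurable ?_
  rw [Filter.EventuallyLE, ae_restrict_iff' measurableSet_uIoc]
  refine Filter.Eventually.of_forall fun v hv ↦ ?_
  rw [uIoc_of_le hab] at hv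
  have hv1 : 16 / 25 ≤ v := ha.trans hv.1.le
  have hv0 : 0 < v := hm.trans_le hv1
  show ‖v ^ 2 * θ v‖ ≤ ‖b ^ 2 * (A / (16 / 25))‖
  rw [Real.norm_of_nonneg (mul_nonneg (sq_nonneg v) (θ_nonneg hv0)),
    Real.norm_of_nonneg (by have := A_pos; positivity)]
  exact mul_le_mul (pow_le_pow_left₀ hv0.le hv.2 2) (θ_le hm m_le_w₀ hv1) (θ_nonneg hv0)
    (sq_nonneg b)

/-- The linear part: `∫_{m}^{w₀} v² θ(v) dv = A (w₀² - m²)/2 - B (w₀³ - m³)/3` for `0 < m ≤ w₀`.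
[cite: Yuhjtman2015, Prop. 5] -/
theorem integral_sq_mul_θ_lin {m : ℝ} (hm : 0 < m) (hmw : m ≤ w₀) :
    ∫ v in m..w₀, v ^ 2 * θ v = A * (w₀ ^ 2 - m ^ 2) / 2 - B * (w₀ ^ 3 - m ^ 3) / 3 := by
  have heq : EqOn (fun v ↦ v ^ 2 * θ v) (fun v ↦ A * v - B * v ^ 2) (uIcc m w₀) := by
    intro v hv
    rw [uIcc_of_le hmw] at hv
    have hv0 : 0 < v := hm.trans_le hv.1
    simp only [θ, if_pos hv.2]
    field_simp
  rw [integral_congr heq]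
  have hderiv : ∀ v, HasDerivAt (fun v : ℝ ↦ A * v ^ 2 / 2 - B * v ^ 3 / 3)
      (A * v - B * v ^ 2) v := by
    intro v
    have h := ((((hasDerivAt_id' v).fun_pow 2).const_mul A).div_const 2).fun_sub
      ((((hasDerivAt_id' v).fun_pow 3).const_mul B).div_const 3)
    refine h.congr_deriv ?_
    norm_num
    ring
  rw [integral_eq_sub_of_hasDerivAt (fun v _ ↦ hderiv v)
    ((by fun_prop : Continuous fun v : ℝ ↦ A * v - B * v ^ 2).intervalIntegrable _ _)]
  ring

/-- The tail: `∫_{w₀}^{R} v² θ(v) dv = (2/3)(w₀⁻³ - R⁻³) - (1/9)(w₀⁻⁹ - R⁻⁹)` for `R ≥ w₀`.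
[cite: Yuhjtman2015, Prop. 5] -/
theorem integral_sq_mul_θ_tail {R : ℝ} (hR : w₀ ≤ R) :
    ∫ v in w₀..R, v ^ 2 * θ v =
      (2 / 3 * (w₀⁻¹ ^ 3 - R⁻¹ ^ 3)) - (1 / 9 * (w₀⁻¹ ^ 9 - R⁻¹ ^ 9)) := by
  have heq : EqOn (fun v ↦ v ^ 2 * θ v) (fun v ↦ 2 * v⁻¹ ^ 4 - v⁻¹ ^ 10) (uIcc w₀ R) := by
    intro v hv
    rw [uIcc_of_le hR] at hv
    have hv0 : 0 < v := w₀_pos.trans_le hv.1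
    have hθ : θ v = hLJ v := by
      rcases hv.1.eq_or_lt with h | h
      · rw [← h, hLJ_w₀]
        simp [θ]
      · simp [θ, not_le.2 h]
    simp only [hθ, hLJ]
    field_simp
  rw [integral_congr heq]
  have hderiv : ∀ v ∈ uIcc w₀ R, HasDerivAt (fun v : ℝ ↦ -(2 / 3 * v⁻¹ ^ 3) + 1 / 9 * v⁻¹ ^ 9)
      (2 * v⁻¹ ^ 4 - v⁻¹ ^ 10) v := by
    intro v hv
    rw [uIcc_of_le hR] at hv
    have hv0 : v ≠ 0 := (w₀_pos.trans_le hv.1).ne'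
    have hi : HasDerivAt (fun y : ℝ ↦ y⁻¹) (-(v ^ 2)⁻¹) v := hasDerivAt_inv hv0
    have h := (((hi.fun_pow 3).const_mul (2 / 3)).fun_neg).fun_add
      ((hi.fun_pow 9).const_mul (1 / 9))
    refine h.congr_deriv ?_
    norm_num
    field_simp
    ring
  have hcont : ContinuousOn (fun v : ℝ ↦ 2 * v⁻¹ ^ 4 - v⁻¹ ^ 10) (uIcc w₀ R) := by
    have hsub : uIcc w₀ R ⊆ {v : ℝ | v ≠ 0} := by
      intro v hv
      rw [uIcc_of_le hR] at hv
      exact (w₀_pos.trans_le hv.1).ne'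
    exact ((continuousOn_const.mul ((continuousOn_inv₀.mono hsub).pow 4)).sub
      ((continuousOn_inv₀.mono hsub).pow 10))
  rw [integral_eq_sub_of_hasDerivAt hderiv hcont.intervalIntegrable]
  ring

/-- **Prop. 5 II, the value of the integral**: `∫_{0.64}^{R} v² θ(v) dv ≤ 1.002` for all
`R ≥ w₀` (the limit is `1.00192…`; printed as `24 ∫_{0.64}^∞ θ w² dw < 24.05`).
[cite: Yuhjtman2015, Prop. 5 II] -/
theorem integral_sq_mul_θ_le {R : ℝ} (hR : w₀ ≤ R) :
    ∫ v in (16 / 25 : ℝ)..R, v ^ 2 * θ v ≤ 1.002 := by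
  have hmw := m_le_w₀
  have hR1 : 1 ≤ R := le_trans (by have := w₀_bounds.1; linarith) hR
  rw [← integral_add_adjacent_intervals (b := w₀) (intervalIntegrable_sq_mul_θ le_rfl hmw)
    (intervalIntegrable_sq_mul_θ hmw hR), integral_sq_mul_θ_lin (by norm_num) hmw,
    integral_sq_mul_θ_tail hR]
  have hw := w₀_bounds
  have h6 := w₀_pow_six
  have e3 : w₀⁻¹ ^ 3 = 5 / 11 * w₀ ^ 3 := by
    have e15 : w₀ ^ 15 = (w₀ ^ 6) ^ 2 * w₀ ^ 3 := by ring
    rw [w₀_inv, mul_pow, ← pow_mul, show 5 * 3 = 15 by norm_num, e15, h6]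
    ring
  have e9 : w₀⁻¹ ^ 9 = 25 / 121 * w₀ ^ 3 := by
    have e45 : w₀ ^ 45 = (w₀ ^ 6) ^ 7 * w₀ ^ 3 := by ring
    rw [w₀_inv, mul_pow, ← pow_mul, show 5 * 9 = 45 by norm_num, e45, h6]
    ring
  have hR3 : 0 ≤ R⁻¹ ^ 3 := by positivity
  have hR9 : R⁻¹ ^ 9 ≤ R⁻¹ ^ 3 :=
    pow_le_pow_of_le_one (by positivity) (inv_le_one_of_one_le₀ hR1) (by norm_num)
  have hw3 : w₀ ^ 3 < 1.14044 ^ 3 := pow_lt_pow_left₀ hw.2 w₀_pos.le (by norm_num)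
  unfold A B
  rw [e3, e9]
  nlinarith [hw.1, hw3, hR3, hR9]

/-! ### The inequality (♣) -/

/-- `Gpoly ≥ 0` on the edge `r = 0.89` (`c ∈ [1/4, 0.342]`): positive Bernstein coefficients.
[cite: Yuhjtman2015, Prop. 5 II] -/
theorem Gpoly_edge₁ {c : ℝ} (hc1 : 1 / 4 ≤ c) (hc2 : c ≤ 171 / 500) : 0 ≤ Gpoly c (89 / 100) := by
  unfold Gpoly
  have hu : 0 ≤ c - 1 / 4 := by linarith
  have hw : 0 ≤ 171 / 500 - c := by linarith
  nlinarith [mul_nonneg (mul_nonneg hu hu) hu, mul_nonneg (mul_nonneg hu hu) hw,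
    mul_nonneg (mul_nonneg hu hw) hw, mul_nonneg (mul_nonneg hw hw) hw]

/-- `Gpoly ≥ 0` on the edge `r = 0.64 + c` (`c ∈ [1/4, 0.342]`): positive Bernstein coefficients.
[cite: Yuhjtman2015, Prop. 5 II] -/
theorem Gpoly_edge₂ {c : ℝ} (hc1 : 1 / 4 ≤ c) (hc2 : c ≤ 171 / 500) :
    0 ≤ Gpoly c (16 / 25 + c) := by
  unfold Gpoly
  have hu : 0 ≤ c - 1 / 4 := by linarith
  have hw : 0 ≤ 171 / 500 - c := by linarith
  nlinarith [mul_nonneg (mul_nonneg (mul_nonneg hu hu) hu) hu,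
    mul_nonneg (mul_nonneg (mul_nonneg hu hu) hu) hw,
    mul_nonneg (mul_nonneg (mul_nonneg hu hu) hw) hw,
    mul_nonneg (mul_nonneg (mul_nonneg hu hw) hw) hw,
    mul_nonneg (mul_nonneg (mul_nonneg hw hw) hw) hw]

/-- **`Gpoly ≥ 0` on the box** `c ∈ [1/4, 0.342]`, `r ∈ [0.89, 0.64 + c]`: `Gpoly` is concave in
`r` (coefficient `-51814/75625` of `r²`), so it lies above the chord between the two edges.
[cite: Yuhjtman2015, Prop. 5 II] -/
theorem Gpoly_nonneg {c r : ℝ} (hc1 : 1 / 4 ≤ c) (hc2 : c ≤ 171 / 500) (hr1 : 89 / 100 ≤ r)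
    (hr2 : r ≤ 16 / 25 + c) : 0 ≤ Gpoly c r := by
  have hE1 := Gpoly_edge₁ hc1 hc2
  have hE2 := Gpoly_edge₂ hc1 hc2
  have key : (16 / 25 + c - 89 / 100) * Gpoly c r =
      (16 / 25 + c - r) * Gpoly c (89 / 100) + (r - 89 / 100) * Gpoly c (16 / 25 + c) +
        51814 / 75625 * ((r - 89 / 100) * (16 / 25 + c - r) * (16 / 25 + c - 89 / 100)) := by
    unfold Gpoly
    ring
  rcases hc1.eq_or_lt with h | h
  · have hr : r = 89 / 100 := by linarith
    rw [hr]
    exact hE1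
  · have hpos : 0 < 16 / 25 + c - 89 / 100 := by linarith
    have h1 : 0 ≤ 16 / 25 + c - r := by linarith
    have h2 : 0 ≤ r - 89 / 100 := by linarith
    have : 0 ≤ (16 / 25 + c - 89 / 100) * Gpoly c r := by
      rw [key]
      exact add_nonneg (add_nonneg (mul_nonneg h1 hE1) (mul_nonneg h2 hE2))
        (mul_nonneg (by norm_num) (mul_nonneg (mul_nonneg h2 h1) hpos.le))
    exact (mul_nonneg_iff_of_pos_left hpos).1 this

/-- The integral with `A` replaced by `Alo`, evaluated:
`∫_{0.64}^{1.14} (Alo - B v)(c² - (v-r)²) dv = Gpoly c r + (4/3) c³ r`.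
[cite: Yuhjtman2015, Prop. 5 II] -/
theorem integral_clubsuit_lo (c r : ℝ) :
    ∫ v in (16 / 25 : ℝ)..(57 / 50), (Alo - B * v) * (c ^ 2 - (v - r) ^ 2) =
      Gpoly c r + 4 / 3 * c ^ 3 * r := by
  set p₀ : ℝ := Alo * (c ^ 2 - r ^ 2) with hp₀
  set p₁ : ℝ := 2 * Alo * r - B * (c ^ 2 - r ^ 2) with hp₁
  set p₂ : ℝ := -Alo - 2 * B * r with hp₂
  set p₃ : ℝ := B with hp₃
  have hderiv : ∀ v, HasDerivAt
      (fun v : ℝ ↦ p₀ * v + p₁ * v ^ 2 / 2 + p₂ * v ^ 3 / 3 + p₃ * v ^ 4 / 4)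
      ((Alo - B * v) * (c ^ 2 - (v - r) ^ 2)) v := by
    intro v
    have h := ((((hasDerivAt_id' v).const_mul p₀).fun_add
      ((((hasDerivAt_id' v).fun_pow 2).const_mul p₁).div_const 2)).fun_add
      ((((hasDerivAt_id' v).fun_pow 3).const_mul p₂).div_const 3)).fun_add
      ((((hasDerivAt_id' v).fun_pow 4).const_mul p₃).div_const 4)
    refine h.congr_deriv ?_
    rw [hp₀, hp₁, hp₂, hp₃]
    norm_num
    ring
  rw [integral_eq_sub_of_hasDerivAt (fun v _ ↦ hderiv v)
    ((by fun_prop : Continuous fun v : ℝ ↦ (Alo - B * v) * (c ^ 2 - (v - r) ^ 2)).intervalIntegrable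
      _ _)]
  rw [hp₀, hp₁, hp₂, hp₃]
  unfold Gpoly Alo B
  ring

/-- **The inequality (♣)** (Yuhjtman 2015, proof of Prop. 5 II): for `c ∈ [1/4, 0.342]` and
`r ∈ [0.89, 0.64 + c]`,
`(4/3) c³ r ≤ ∫_{0.64}^{1.14} (A - B v)(c² - (v - r)²) dv`,
so that (with `π/r` times this being a lower bound for `∫_{B(x,c)} θ^{0.64}`) the average of
`θ^{0.64}` over `B(x, c)`, `‖x‖ = r`, is at least `1 ≥ h(r)`. [cite: Yuhjtman2015, Prop. 5 II] -/
theorem clubsuit {c r : ℝ} (hc1 : 1 / 4 ≤ c) (hc2 : c ≤ 171 / 500) (hr1 : 89 / 100 ≤ r)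
    (hr2 : r ≤ 16 / 25 + c) :
    4 / 3 * c ^ 3 * r ≤ ∫ v in (16 / 25 : ℝ)..(57 / 50), (A - B * v) * (c ^ 2 - (v - r) ^ 2) := by
  have hlo : Gpoly c r + 4 / 3 * c ^ 3 * r ≤
      ∫ v in (16 / 25 : ℝ)..(57 / 50), (A - B * v) * (c ^ 2 - (v - r) ^ 2) := by
    rw [← integral_clubsuit_lo]
    refine integral_mono_on (by norm_num) ((by fun_prop : Continuous fun v : ℝ ↦
        (Alo - B * v) * (c ^ 2 - (v - r) ^ 2)).intervalIntegrable _ _)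
      ((by fun_prop : Continuous fun v : ℝ ↦
        (A - B * v) * (c ^ 2 - (v - r) ^ 2)).intervalIntegrable _ _) fun v hv ↦ ?_
    have hw : 0 ≤ c ^ 2 - (v - r) ^ 2 := by
      have h1 : -c ≤ v - r := by linarith [hv.1]
      have h2 : v - r ≤ c := by linarith [hv.2]
      nlinarith
    have hA := Alo_lt_A
    nlinarith
  exact (le_add_of_nonneg_left (Gpoly_nonneg hc1 hc2 hr1 hr2)).trans hlo

/-! ### The final polynomial inequality of Cor. 7 -/

/-- **Cor. 7, last step**: `2 a⁶ + 24 J a⁹ < 1` for `0 ≤ a ≤ 0.684` with `J ≤ 1.002`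
(printed with `24 J = 24.05`: "by monotonicity, we see that this does not hold for `a ≤ 0.684`").
[cite: Yuhjtman2015, Cor. 7] -/
theorem final_ineq {a : ℝ} (ha0 : 0 ≤ a) (ha : a ≤ 171 / 250) :
    2 * a ^ 6 + 24 * 1.002 * a ^ 9 < 1 := by
  have h6 : a ^ 6 ≤ (171 / 250) ^ 6 := pow_le_pow_left₀ ha0 ha 6
  have h9 : a ^ 9 ≤ (171 / 250) ^ 9 := pow_le_pow_left₀ ha0 ha 9
  nlinarith [h6, h9]

end Yuhjtman2015

open Yuhjtman2015

/-- The integrand `lensDensity · θcut` of the shell formula is interval integrable. [folklore] -/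
theorem intervalIntegrable_lensDensity_mul_θcut (r c a b : ℝ) :
    IntervalIntegrable (fun v ↦ lensDensity r c v * θcut (16 / 25) v) volume a b :=
  (intervalIntegrable_θcut (by norm_num) m_le_w₀ a b).continuousOn_mul
    (continuous_lensDensity r c).continuousOn

/-! ### Prop. 4: the ball mean-value inequality for the radial majorant -/

/-- **Prop. 4 (mean-value inequality), transcribed**: if `‖z‖ = r`, `0 < c` and the ball `B(z,c)`
stays outside `B(0, 0.64)` (`0.64 ≤ r - c`), then
`(4π/3) c³ h(r) ≤ (4π/3) c³ θ(r) ≤ ∫_{B(z,c)} θ^{0.64}(‖y‖) dy`.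
Printed: "`Θ` is subharmonic … `h̃(‖x‖) ≤ θ(x) ≤ (1/|B_x|) ∫_{B_x} θ(‖y‖) dy`"; here: shell
formula, the substitution `v = r ± s`, and the midpoint inequality for `v θ(v)`.
[cite: Yuhjtman2015, Prop. 4] -/
theorem ball_integral_ge_of_far {z : EuclideanSpace ℝ (Fin 3)} {c : ℝ} (hc : 0 < c)
    (hfar : 16 / 25 ≤ ‖z‖ - c) :
    4 / 3 * Real.pi * c ^ 3 * hLJ ‖z‖ ≤ ∫ y in ball z c, θcut (16 / 25) ‖y‖ := by
  set r := ‖z‖ with hr_def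
  have hcr : c < r := by linarith
  have hr : 0 < r := hc.trans hcr
  set F : ℝ → ℝ := fun v ↦ lensDensity r c v * θcut (16 / 25) v with hF
  have hFi : ∀ a b, IntervalIntegrable F volume a b := intervalIntegrable_lensDensity_mul_θcut r c
  rw [setIntegral_ball_fun_norm finrank_euclideanSpace_fin hc hcr (measurable_θcut _)]
  change 4 / 3 * Real.pi * c ^ 3 * hLJ r ≤ ∫ v in (r - c)..(r + c), F v
  -- split at `r` and fold the two halves onto `[0, c]`
  rw [← integral_add_adjacent_intervals (b := r) (hFi _ _) (hFi _ _)]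
  have hleft : ∫ v in (r - c)..r, F v = ∫ s in (0 : ℝ)..c, F (r - s) := by
    rw [intervalIntegral.integral_comp_sub_left F r, sub_zero]
  have hright : ∫ v in r..(r + c), F v = ∫ s in (0 : ℝ)..c, F (r + s) := by
    rw [intervalIntegral.integral_comp_add_left F r, add_zero]
  have hI1 : IntervalIntegrable (fun s ↦ F (r - s)) volume 0 c := by
    simpa using (hFi (r - 0) (r - c)).comp_sub_left r
  have hI2 : IntervalIntegrable (fun s ↦ F (r + s)) volume 0 c := by
    simpa using (hFi (0 + r) (c + r)).comp_add_left r
  rw [hleft, hright, ← intervalIntegral.integral_add hI1 hI2]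
  -- pointwise: `F(r-s) + F(r+s) = (π/r)(c² - s²)(g_θ(r-s) + g_θ(r+s)) ≥ (π/r)(c² - s²) 2 g_θ(r)`
  have hkey : ∫ s in (0 : ℝ)..c, Real.pi / r * (c ^ 2 - s ^ 2) * (2 * gθ r) ≤
      ∫ s in (0 : ℝ)..c, (F (r - s) + F (r + s)) := by
    refine integral_mono_on hc.le ((by fun_prop : Continuous fun s : ℝ ↦
        Real.pi / r * (c ^ 2 - s ^ 2) * (2 * gθ r)).intervalIntegrable _ _)
      (hI1.add hI2) fun s hs ↦ ?_
    have hs1 : 16 / 25 ≤ r - s := by linarith [hs.2]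
    have hs2 : 16 / 25 ≤ r + s := by linarith [hs.1]
    have e1 : F (r - s) = Real.pi / r * (c ^ 2 - s ^ 2) * gθ (r - s) := by
      simp only [hF, lensDensity, θcut_of_le hs1, gθ]
      ring
    have e2 : F (r + s) = Real.pi / r * (c ^ 2 - s ^ 2) * gθ (r + s) := by
      simp only [hF, lensDensity, θcut_of_le hs2, gθ]
      ring
    rw [e1, e2]
    have hmid := two_mul_gθ_le hs.1 (hs.2.trans_lt hcr)
    have hw : 0 ≤ Real.pi / r * (c ^ 2 - s ^ 2) :=
      mul_nonneg (div_nonneg Real.pi_pos.le hr.le) (by nlinarith [hs.1, hs.2])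
    nlinarith
  -- the left-hand side integrates to `(4π/3) c³ θ(r) ≥ (4π/3) c³ h(r)`
  have hval : ∫ s in (0 : ℝ)..c, Real.pi / r * (c ^ 2 - s ^ 2) * (2 * gθ r) =
      4 / 3 * Real.pi * c ^ 3 * θ r := by
    have h1 : ∫ s in (0 : ℝ)..c, Real.pi / r * (c ^ 2 - s ^ 2) * (2 * gθ r) =
        (Real.pi / r * (2 * gθ r)) * ∫ s in (0 : ℝ)..c, (c ^ 2 - s ^ 2) := by
      rw [← intervalIntegral.integral_const_mul]
      refine integral_congr fun s _ ↦ ?_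
      ring
    have h2 : ∫ s in (0 : ℝ)..c, (c ^ 2 - s ^ 2) = 2 / 3 * c ^ 3 := by
      rw [integral_sub intervalIntegrable_const (intervalIntegral.intervalIntegrable_pow 2),
        intervalIntegral.integral_const, integral_pow]
      simp
      ring
    rw [h1, h2]
    unfold gθ
    field_simp
    ring
  have hθ : hLJ r ≤ θ r := hLJ_le_θ hr
  have hc3 : 0 ≤ 4 / 3 * Real.pi * c ^ 3 := by positivity
  calc 4 / 3 * Real.pi * c ^ 3 * hLJ r ≤ 4 / 3 * Real.pi * c ^ 3 * θ r :=
        mul_le_mul_of_nonneg_left hθ hc3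
    _ = _ := hval.symm
    _ ≤ _ := hkey

/-! ### Prop. 5 II near the truncation radius: the inequality (♣) -/

/-- **Prop. 5 II, the case `0.89 ≤ ‖z‖ < 0.64 + c`** (`c ≤ 0.342`): still
`(4π/3) c³ h(‖z‖) ≤ ∫_{B(z,c)} θ^{0.64}(‖y‖) dy`, by the explicit lower bound
`∫_{B(z,c)} θ^{0.64} ≥ (π/r) ∫_{0.64}^{1.14} (A - B v)(c² - (v-r)²) dv ≥ (4π/3) c³ ≥ (4π/3) c³ h(r)`
(the inequality (♣) `clubsuit` and `h ≤ 1`). [cite: Yuhjtman2015, Prop. 5 II] -/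
theorem ball_integral_ge_of_near {z : EuclideanSpace ℝ (Fin 3)} {c : ℝ} (hc2 : c ≤ 171 / 500)
    (hz : 89 / 100 ≤ ‖z‖) (hnear : ‖z‖ - c < 16 / 25) :
    4 / 3 * Real.pi * c ^ 3 * hLJ ‖z‖ ≤ ∫ y in ball z c, θcut (16 / 25) ‖y‖ := by
  set r := ‖z‖ with hr_def
  have hc1 : 1 / 4 ≤ c := by linarith
  have hc : 0 < c := by linarith
  have hcr : c < r := by linarith
  have hr : 0 < r := hc.trans hcr
  rw [setIntegral_ball_fun_norm finrank_euclideanSpace_fin hc hcr (measurable_θcut _)]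
  -- restrict to `[0.64, 1.14]`, where the integrand is `(π/r)(A - Bv)(c² - (v-r)²)`
  have hmono : ∫ v in (16 / 25 : ℝ)..(57 / 50), lensDensity r c v * θcut (16 / 25) v ≤
      ∫ v in (r - c)..(r + c), lensDensity r c v * θcut (16 / 25) v := by
    refine integral_mono_interval (by linarith) (by norm_num) (by linarith) ?_
      (intervalIntegrable_lensDensity_mul_θcut r c _ _)
    rw [EventuallyLE, ae_restrict_iff' measurableSet_Ioc]
    refine Eventually.of_forall fun v hv ↦ mul_nonneg ?_ (θcut_nonneg (by norm_num) v)
    exact lensDensity_nonneg hr (by linarith [hv.1]) hv.1.le hv.2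
  have heq : ∫ v in (16 / 25 : ℝ)..(57 / 50), lensDensity r c v * θcut (16 / 25) v =
      Real.pi / r * ∫ v in (16 / 25 : ℝ)..(57 / 50), (A - B * v) * (c ^ 2 - (v - r) ^ 2) := by
    rw [← intervalIntegral.integral_const_mul]
    refine integral_congr fun v hv ↦ ?_
    rw [uIcc_of_le (by norm_num)] at hv
    have hv0 : 0 < v := lt_of_lt_of_le (by norm_num) hv.1
    have hvw : v ≤ w₀ := hv.2.trans (by have := w₀_bounds.1; linarith)
    simp only [θcut_of_le hv.1, θ, if_pos hvw, lensDensity]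
    field_simp
  have hclub := clubsuit hc1 hc2 hz (by linarith)
  have hpr : 0 < Real.pi / r := div_pos Real.pi_pos hr
  have h1 : hLJ r ≤ 1 := hLJ_le_one r
  have hc3 : 0 ≤ 4 / 3 * Real.pi * c ^ 3 := by positivity
  calc 4 / 3 * Real.pi * c ^ 3 * hLJ r ≤ 4 / 3 * Real.pi * c ^ 3 * 1 :=
        mul_le_mul_of_nonneg_left h1 hc3
    _ = Real.pi / r * (4 / 3 * c ^ 3 * r) := by field_simp
    _ ≤ Real.pi / r * ∫ v in (16 / 25 : ℝ)..(57 / 50), (A - B * v) * (c ^ 2 - (v - r) ^ 2) :=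
        mul_le_mul_of_nonneg_left hclub hpr.le
    _ = _ := heq.symm
    _ ≤ _ := hmono

/-- **The ball bound** (Prop. 4 + (♣)): for `‖z‖ ≥ 0.89` and `0 < c ≤ 0.342`,
`(4π/3) c³ h(‖z‖) ≤ ∫_{B(z,c)} θ^{0.64}(‖y‖) dy`. [cite: Yuhjtman2015, Prop. 5 II] -/
theorem ball_integral_ge {z : EuclideanSpace ℝ (Fin 3)} {c : ℝ} (hc : 0 < c) (hc2 : c ≤ 171 / 500)
    (hz : 89 / 100 ≤ ‖z‖) :
    4 / 3 * Real.pi * c ^ 3 * hLJ ‖z‖ ≤ ∫ y in ball z c, θcut (16 / 25) ‖y‖ := by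
  rcases le_or_gt (16 / 25 : ℝ) (‖z‖ - c) with hfar | hnear
  · exact ball_integral_ge_of_far hc hfar
  · exact ball_integral_ge_of_near hc2 hz hnear

/-! ### The total mass of `θ^{0.64}` (polar coordinates about the origin) -/

/-- `∫_{‖y‖ ≤ R} θ^{0.64}(‖y‖) dy = 4π ∫_{0.64}^{R} v² θ(v) dv` (`R ≥ 0.64`).
[cite: Yuhjtman2015, Prop. 5] -/
theorem integral_closedBall_θcut {R : ℝ} (hR : 16 / 25 ≤ R) :
    ∫ y in closedBall (0 : EuclideanSpace ℝ (Fin 3)) R, θcut (16 / 25) ‖y‖ =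
      4 * Real.pi * ∫ v in (16 / 25 : ℝ)..R, v ^ 2 * θ v := by
  rw [← MeasureTheory.integral_indicator measurableSet_closedBall]
  have hind : (closedBall (0 : EuclideanSpace ℝ (Fin 3)) R).indicator
      (fun y ↦ θcut (16 / 25) ‖y‖) = fun y ↦ (Icc (16 / 25) R).indicator θ ‖y‖ := by
    funext y
    simp only [Set.indicator, mem_closedBall, dist_zero_right, mem_Icc, θcut]
    by_cases h1 : ‖y‖ ≤ R <;> by_cases h2 : (16 : ℝ) / 25 ≤ ‖y‖ <;> simp [h1, h2]
  rw [hind, integral_fun_norm_addHaar (volume : Measure (EuclideanSpace ℝ (Fin 3)))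
    (fun v ↦ (Icc (16 / 25) R).indicator θ v), finrank_euclideanSpace_fin]
  have hinner : ∫ v in Ioi (0 : ℝ), v ^ (3 - 1) • (Icc (16 / 25) R).indicator θ v =
      ∫ v in (16 / 25 : ℝ)..R, v ^ 2 * θ v := by
    have h1 : EqOn (fun v : ℝ ↦ v ^ (3 - 1) • (Icc (16 / 25) R).indicator θ v)
        ((Icc (16 / 25) R).indicator fun v ↦ v ^ 2 * θ v) (Ioi 0) := by
      intro v _
      simp only [Set.indicator, mem_Icc, smul_eq_mul]
      split_ifs <;> simp
    have h2 : Ioi (0 : ℝ) ∩ Icc (16 / 25) R = Icc (16 / 25) R := by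
      ext v
      simp only [mem_inter_iff, mem_Ioi, mem_Icc]
      constructor
      · exact fun h ↦ h.2
      · exact fun h ↦ ⟨lt_of_lt_of_le (by norm_num) h.1, h⟩
    rw [setIntegral_congr_fun measurableSet_Ioi h1, setIntegral_indicator measurableSet_Icc, h2,
      integral_Icc_eq_integral_Ioc, ← intervalIntegral.integral_of_le hR]
  rw [hinner, measureReal_def, EuclideanSpace.volume_ball_fin_three, ENNReal.toReal_mul,
    ← ENNReal.ofReal_pow zero_le_one, one_pow, ENNReal.toReal_ofReal zero_le_one,
    ENNReal.toReal_ofReal (by positivity : (0 : ℝ) ≤ Real.pi * 4 / 3)]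
  simp only [nsmul_eq_mul, smul_eq_mul]
  ring

/-- `θ^{0.64}(‖·‖)` is integrable on bounded sets (bounded and measurable). [folklore] -/
theorem integrableOn_θcut_norm {s : Set (EuclideanSpace ℝ (Fin 3))} (hs : volume s ≠ ∞) :
    IntegrableOn (fun y : EuclideanSpace ℝ (Fin 3) ↦ θcut (16 / 25) ‖y‖) s volume := by
  refine Measure.integrableOn_of_bounded hs
    ((measurable_θcut _).comp measurable_norm).aestronglyMeasurable
    (M := A / (16 / 25)) (Eventually.of_forall fun y ↦ ?_)
  rw [Real.norm_of_nonneg (θcut_nonneg (by norm_num) _)]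
  exact θcut_le (by norm_num) m_le_w₀ _

/-! ### Prop. 5: the energy of a particle in an `a`-separated configuration -/

open scoped Function in
/-- **Prop. 5 (II, for all `0 < a ≤ 0.684`)**: if the points `z i`, `i ∈ s`, are pairwise at
distance `≥ 2c` with `0 < c ≤ 0.342`, then `Σ_{i ∈ s} h(‖z i‖) ≤ 3 · 1.002 / c³`
(printed: `μ(a) ≤ (24/a³) ∫_{0.64}^∞ θ(w) w² dw < 24.05/a³`, `a = 2c`): drop the points with
`‖z‖ ≤ 0.89` (`h ≤ 0`), bound each remaining `h(‖z i‖)` by the average of `θ^{0.64}` over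
`B(z i, c)` (`ball_integral_ge`), and add over the disjoint balls. [cite: Yuhjtman2015, Prop. 5] -/
theorem sum_hLJ_norm_le {ι : Type*} (s : Finset ι) (z : ι → EuclideanSpace ℝ (Fin 3)) {c : ℝ}
    (hc : 0 < c) (hc2 : c ≤ 171 / 500)
    (hsep : ∀ i ∈ s, ∀ j ∈ s, i ≠ j → 2 * c ≤ dist (z i) (z j)) :
    ∑ i ∈ s, hLJ ‖z i‖ ≤ 3 * 1.002 / c ^ 3 := by
  classical
  set Φ : EuclideanSpace ℝ (Fin 3) → ℝ := fun y ↦ θcut (16 / 25) ‖y‖ with hΦ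
  set K := s.filter (fun i ↦ 89 / 100 ≤ ‖z i‖) with hK
  have hKs : K ⊆ s := Finset.filter_subset _ _
  -- points with `‖z‖ < 0.89` contribute `≤ 0`
  have h1 : ∑ i ∈ s, hLJ ‖z i‖ ≤ ∑ i ∈ K, hLJ ‖z i‖ := by
    rw [← Finset.sum_filter_add_sum_filter_not s (fun i ↦ 89 / 100 ≤ ‖z i‖)]
    have : ∑ i ∈ s.filter (fun i ↦ ¬ 89 / 100 ≤ ‖z i‖), hLJ ‖z i‖ ≤ 0 :=
      Finset.sum_nonpos fun i hi ↦
        hLJ_nonpos (norm_nonneg _) (le_of_lt (not_le.1 (Finset.mem_filter.1 hi).2))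
    linarith
  -- each kept point: `(4π/3) c³ h ≤ ∫_{B(z,c)} Φ`
  have h2 : ∑ i ∈ K, 4 / 3 * Real.pi * c ^ 3 * hLJ ‖z i‖ ≤ ∑ i ∈ K, ∫ y in ball (z i) c, Φ y :=
    Finset.sum_le_sum fun i hi ↦ ball_integral_ge hc hc2 (Finset.mem_filter.1 hi).2
  -- the balls are disjoint and contained in `closedBall 0 R`
  set R : ℝ := w₀ + c + ∑ i ∈ s, ‖z i‖ with hR_def
  have hsum0 : 0 ≤ ∑ i ∈ s, ‖z i‖ := Finset.sum_nonneg fun i _ ↦ norm_nonneg _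
  have hRw : w₀ ≤ R := by rw [hR_def]; linarith
  have hRm : 16 / 25 ≤ R := m_le_w₀.trans hRw
  have hdisj : Set.Pairwise (↑K : Set ι) (Disjoint on fun i ↦ ball (z i) c) := by
    intro i hi j hj hij
    refine ball_disjoint_ball ?_
    rw [← two_mul]
    exact hsep i (hKs hi) j (hKs hj) hij
  have hsub : ∀ i ∈ K, ball (z i) c ⊆ closedBall (0 : EuclideanSpace ℝ (Fin 3)) R := by
    intro i hi y hy
    rw [mem_closedBall, dist_zero_right]
    rw [mem_ball] at hy
    have h1 : ‖z i‖ ≤ ∑ j ∈ s, ‖z j‖ :=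
      Finset.single_le_sum (f := fun j ↦ ‖z j‖) (fun _ _ ↦ norm_nonneg _) (hKs hi)
    have h2 : ‖y‖ ≤ ‖z i‖ + dist y (z i) := by
      rw [dist_eq_norm]
      have := norm_le_norm_add_norm_sub' y (z i)
      linarith [norm_sub_rev y (z i)]
    have := w₀_pos
    linarith
  have hint : IntegrableOn Φ (closedBall (0 : EuclideanSpace ℝ (Fin 3)) R) volume :=
    integrableOn_θcut_norm measure_closedBall_lt_top.ne
  have h3 : ∑ i ∈ K, ∫ y in ball (z i) c, Φ y = ∫ y in ⋃ i ∈ K, ball (z i) c, Φ y :=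
    (integral_biUnion_finset K (fun _ _ ↦ measurableSet_ball) hdisj
      (fun i hi ↦ hint.mono_set (hsub i hi))).symm
  have h4 : ∫ y in ⋃ i ∈ K, ball (z i) c, Φ y ≤
      ∫ y in closedBall (0 : EuclideanSpace ℝ (Fin 3)) R, Φ y :=
    setIntegral_mono_set hint (Eventually.of_forall fun y ↦ θcut_nonneg (by norm_num) ‖y‖)
      (Set.iUnion₂_subset hsub).eventuallyLE
  have h5 := integral_closedBall_θcut hRm
  have h6 := integral_sq_mul_θ_le hRw
  -- combine
  have hc3 : 0 < c ^ 3 := by positivity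
  have htot : 4 / 3 * Real.pi * c ^ 3 * ∑ i ∈ K, hLJ ‖z i‖ ≤ 4 * Real.pi * 1.002 := by
    rw [Finset.mul_sum]
    calc ∑ i ∈ K, 4 / 3 * Real.pi * c ^ 3 * hLJ ‖z i‖ ≤ ∑ i ∈ K, ∫ y in ball (z i) c, Φ y := h2
      _ ≤ ∫ y in closedBall (0 : EuclideanSpace ℝ (Fin 3)) R, Φ y := h3.le.trans h4
      _ = 4 * Real.pi * ∫ v in (16 / 25 : ℝ)..R, v ^ 2 * θ v := h5
      _ ≤ 4 * Real.pi * 1.002 := mul_le_mul_of_nonneg_left h6 (by positivity)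
  have hK' : ∑ i ∈ K, hLJ ‖z i‖ ≤ 3 * 1.002 / c ^ 3 := by
    rw [le_div_iff₀ hc3]
    have hX : 4 / 3 * c ^ 3 * (∑ i ∈ K, hLJ ‖z i‖) - 4 * 1.002 ≤ 0 := by
      by_contra h
      push Not at h
      have := mul_pos Real.pi_pos h
      linarith
    linarith
  exact h1.trans hK'

/-! ### Cor. 7: the discharge -/

/-- `h = -12 · lennardJones` (the two normalisations: `Φ = r⁻¹² - 2r⁻⁶ = 12 V_LJ`).
[cite: Yuhjtman2015, §1] -/
theorem lennardJones_eq_hLJ (r : ℝ) : lennardJones r = -(1 / 12) * hLJ r := by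
  unfold lennardJones hLJ
  ring

/-- **Yuhjtman 2015, Cor. 7 (discharge of `Yuhjtman2015_minDistance`)**: every Lennard-Jones
ground state of `N` particles in `ℝ³` has all interparticle distances `> 0.684`. At a closest
pair `(i₀, j₀)`, `a = |x_{i₀} - x_{j₀}|`, the removal inequality gives
`0 ≤ h(a) + Σ_{k ≠ i₀, j₀} h(|x_k - x_{i₀}|) ≤ h(a) + 24 J/a³` (Prop. 5 applied to the
`a`-separated points `x_k - x_{i₀}`), i.e. `1 ≤ 2a⁶ + 24 J a⁹`, which fails for `a ≤ 0.684`.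
[cite: Yuhjtman2015, Cor. 7] -/
theorem Yuhjtman2015_minDistance_holds : Yuhjtman2015_minDistance := by
  intro N x hx i j hij
  by_contra hle
  rw [not_lt] at hle
  -- a closest pair `(i₀, j₀)`
  obtain ⟨p, hp, hmin⟩ := Finset.exists_min_image Finset.univ.offDiag
    (fun p : Fin N × Fin N ↦ dist (x p.1) (x p.2)) ⟨(i, j), by simp [hij]⟩
  obtain ⟨i₀, j₀⟩ := p
  have hij₀ : i₀ ≠ j₀ := by simpa using hp
  set a := dist (x i₀) (x j₀) with ha_def
  have ha : 0 < a := dist_pos.2 (hx.1.ne hij₀)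
  have hsep : ∀ k l, k ≠ l → a ≤ dist (x k) (x l) := fun k l hkl ↦ hmin (k, l) (by simp [hkl])
  have ha2 : a ≤ 171 / 250 := (hsep i j hij).trans (hle.trans_eq (by norm_num))
  -- the removal inequality: the minus-energy of `i₀` is `≥ 0`
  have h0 := siteEnergy_nonpos_of_isGroundState (by norm_num) hx i₀
  have hsite : siteEnergy lennardJones x i₀ =
      -(1 / 12) * ∑ k ∈ Finset.univ.erase i₀, hLJ (dist (x i₀) (x k)) := by
    simp only [siteEnergy, lennardJones_eq_hLJ, Finset.mul_sum]
  rw [hsite] at h0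
  have hpos : 0 ≤ ∑ k ∈ Finset.univ.erase i₀, hLJ (dist (x i₀) (x k)) := by linarith
  -- split off the partner `j₀`
  have hj₀ : j₀ ∈ Finset.univ.erase i₀ := Finset.mem_erase.2 ⟨hij₀.symm, Finset.mem_univ _⟩
  rw [← Finset.add_sum_erase _ _ hj₀] at hpos
  -- Prop. 5 for the `a`-separated points `x k - x i₀`, `k ≠ i₀, j₀`
  set s := (Finset.univ.erase i₀).erase j₀ with hs_def
  have hsum := sum_hLJ_norm_le s (fun k ↦ x k - x i₀) (c := a / 2) (by positivity) (by linarith)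
    (fun k _ l _ hkl ↦ by
      rw [dist_eq_norm, show x k - x i₀ - (x l - x i₀) = x k - x l by abel, ← dist_eq_norm]
      have := hsep k l hkl
      linarith)
  have hsum' : ∑ k ∈ s, hLJ (dist (x i₀) (x k)) ≤ 3 * 1.002 / (a / 2) ^ 3 := by
    refine le_of_eq_of_le (Finset.sum_congr rfl fun k _ ↦ ?_) hsum
    rw [dist_comm, dist_eq_norm]
  -- `0 ≤ h(a) + 24 J / a³`, i.e. `a¹² (h(a) + 24 J/a³) = 2a⁶ - 1 + 24 J a⁹ ≥ 0`
  have hkey : 0 ≤ hLJ a + 3 * 1.002 / (a / 2) ^ 3 := by linarith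
  have hexp : a ^ 12 * (hLJ a + 3 * 1.002 / (a / 2) ^ 3) = 2 * a ^ 6 - 1 + 24 * 1.002 * a ^ 9 := by
    unfold hLJ
    field_simp
    ring
  have h12 : 0 ≤ a ^ 12 * (hLJ a + 3 * 1.002 / (a / 2) ^ 3) := mul_nonneg (by positivity) hkey
  rw [hexp] at h12
  have hfin := final_ineq ha.le ha2
  linarith

end Literature.MathematicalPhysics.StatisticalMechanics

end
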